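import Summits.QuantumFields.BalabanUV.T4Continuum.Support.NE7SliceGreenTorus
import Literature.MathematicalPhysics.QuantumFieldTheory.Balaban1983to89.B5G115SupBound
import HarnessLib

/-!
# NE7BlockMeanZeroSup — A POINCARÉ LETTER IN SUP NORM ON THE BLOCKED TORUS: a function with vanishing block means (`Q′_k f = 0`) whose steps INSIDE
# blocks are at most `g` is bounded by `(d+1)(n−1)·g` everywhere

Cell `pub-balaban`, sub-cell t4, lineage `b2b-balaban-t4-ne7-p1`, gen 73 (CRUX PROVER NE7 #1).  Memo `t4/b2b-balaban-t4-ne7-p1-g73/REP-FLAT-ROAD-v2.md` §2 (s5): the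
step gauge function of the sup induction is `framePot∘blockOf + n·λ₀` with B5's Landau function `λ₀` (`Q′_kλ₀ = 0`, `B5Value126.QsOp_lambda0`), and its SUP must be
small ABSOLUTELY for the nonabelian step to be perturbative; `λ₀`'s block means vanish and its in-block steps are the field `x̃ − x̃₂` (B1 `NE7LandauLinearSup`), so the
sup is a block diameter times that field.  THIS FILE is that elementary letter on lit-balaban's blocked torus `Tor (fine n M)` (`B5Block118.bpt`, `B5Blocks16.blockOf`):
`‖f(x)‖ = ‖f(x) − mean_{B(x)} f‖ ≤ max_{x′ ∈ B(x)} ‖f(x) − f(x′)‖ ≤ (Σ_ν |j_ν − j′_ν|)·g ≤ (d+1)(n−1)·g` along the coordinate staircase inside the block.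
WHAT ([folklore]; 0 def, 0 sorry; dimension `d + 1`, `n ≥ 1` points per block side, any period vector `M`).  §1 `bpt_update_succ` (a unit step inside a block is a
torus unit step); §2 `norm_sub_le_coord` (one coordinate), `norm_sub_le_stair` (the staircase: `‖f(ny + j′) − f(ny + j)‖ ≤ (d+1)(n−1)·g`); §3
**`norm_le_of_blockMean_zero`**: `Q′_kf = 0` and in-block steps `≤ g` ⟹ `‖f‖_∞ ≤ (d+1)(n−1)·g`.
HONEST FRAMING (page 1): finite bookkeeping; nothing printed is asserted; REP♭ NOT proved; (APE) at the trivial flat datum conditional on it; NOT NE7; spine 0∕9;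
finite T⁴ rung (B)+1 — NOT infinite volume, NOT mass gap, NOT BetaPertH, NOT Clay.  Continuum YM on T⁴ ⇐ BetaPertH ∧ nine spine estimates (0/9 proved); BetaPertH ⇐
(D1) ∧ (D4) ∧ CAP+tail; G-an2-4 gates asym, D1 and NE2/3/4.
-/

set_option autoImplicit false

open scoped BigOperators Matrix
open Finset

namespace Summit.QuantumFields.BalabanUV.T4Continuum.NE7BlockMeanZeroSup

open Literature.MathematicalPhysics.QuantumFieldTheory.Balaban1983to89
open B5Prop11Plancherel (Tor fine unitVec)
open B5Block118 (QsOp QsOp_mulVec bpt iota up)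
open B5Blocks16 (blockOf blockOf_bpt)
open B5G115SupBound (exists_eq_bpt_blockOf)

noncomputable section

variable {d : ℕ} (n : ℕ) [NeZero n] (M : Fin (d + 1) → ℕ) [∀ μ, NeZero (M μ)]

/-! ## §1 A unit step inside a block -/

omit [NeZero n] [∀ μ, NeZero (M μ)] in
/-- raising the `ν`-offset by one inside the block is the torus unit step `+ e_ν`. [folklore] -/
theorem bpt_update_succ (y : Tor M) (j : Fin (d + 1) → Fin n) (ν : Fin (d + 1)) (h : (j ν : ℕ) + 1 < n) :
    bpt n M y (Function.update j ν ⟨(j ν : ℕ) + 1, h⟩) = bpt n M y j + unitVec (fine n M) ν := by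
  funext μ
  simp only [bpt, iota, Pi.add_apply, unitVec]
  by_cases hμ : μ = ν
  · subst hμ
    rw [Function.update_self, Pi.single_eq_same]
    push_cast
    ring
  · rw [Function.update_of_ne hμ, Pi.single_eq_of_ne hμ, add_zero]

/-! ## §2 The staircase inside a block -/

omit [NeZero n] [∀ μ, NeZero (M μ)] in
/-- ONE COORDINATE: moving the `ν`-offset from `j_ν` to `j_ν + m` costs `m·g`. [folklore] -/
theorem norm_sub_le_coord (f : Tor (fine n M) → ℂ) {g : ℝ} (hg : 0 ≤ g)
    (hstep : ∀ (y : Tor M) (j : Fin (d + 1) → Fin n) (ν : Fin (d + 1)) (h : (j ν : ℕ) + 1 < n),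
      ‖f (bpt n M y (Function.update j ν ⟨(j ν : ℕ) + 1, h⟩)) - f (bpt n M y j)‖ ≤ g)
    (y : Tor M) (j : Fin (d + 1) → Fin n) (ν : Fin (d + 1)) :
    ∀ (m : ℕ) (h : (j ν : ℕ) + m < n), ‖f (bpt n M y (Function.update j ν ⟨(j ν : ℕ) + m, h⟩)) - f (bpt n M y j)‖ ≤ (m : ℝ) * g
  | 0, h => by
      have : Function.update j ν ⟨(j ν : ℕ) + 0, h⟩ = j := by
        rw [show (⟨(j ν : ℕ) + 0, h⟩ : Fin n) = j ν from Fin.ext (by simp), Function.update_eq_self]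
      rw [this, sub_self, norm_zero, Nat.cast_zero, zero_mul]
  | m + 1, h => by
      have h' : (j ν : ℕ) + m < n := by omega
      have ih := norm_sub_le_coord f hg hstep y j ν m h'
      set j₁ : Fin (d + 1) → Fin n := Function.update j ν ⟨(j ν : ℕ) + m, h'⟩ with hj₁
      have hj₁ν : (j₁ ν : ℕ) + 1 < n := by rw [hj₁, Function.update_self]; simpa [add_assoc] using h
      have hnext : Function.update j₁ ν ⟨(j₁ ν : ℕ) + 1, hj₁ν⟩ = Function.update j ν ⟨(j ν : ℕ) + (m + 1), h⟩ := by
        funext μ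
        by_cases hμ : μ = ν
        · rw [hμ, Function.update_self, Function.update_self]
          exact Fin.ext (by simp [hj₁, add_assoc])
        · rw [Function.update_of_ne hμ, Function.update_of_ne hμ, hj₁, Function.update_of_ne hμ]
      have hs := hstep y j₁ ν hj₁ν
      rw [hnext] at hs
      calc _ ≤ ‖f (bpt n M y (Function.update j ν ⟨(j ν : ℕ) + (m + 1), h⟩)) - f (bpt n M y j₁)‖ + ‖f (bpt n M y j₁) - f (bpt n M y j)‖ := by
            rw [← sub_add_sub_cancel]; exact norm_add_le _ _
        _ ≤ g + (m : ℝ) * g := add_le_add hs ih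
        _ = ((m + 1 : ℕ) : ℝ) * g := by push_cast; ring

omit [∀ μ, NeZero (M μ)] in
/-- ONE COORDINATE, either direction: offsets differing only at `ν` cost `(n−1)·g`. [folklore] -/
theorem norm_sub_le_coord' (f : Tor (fine n M) → ℂ) {g : ℝ} (hg : 0 ≤ g)
    (hstep : ∀ (y : Tor M) (j : Fin (d + 1) → Fin n) (ν : Fin (d + 1)) (h : (j ν : ℕ) + 1 < n),
      ‖f (bpt n M y (Function.update j ν ⟨(j ν : ℕ) + 1, h⟩)) - f (bpt n M y j)‖ ≤ g)
    (y : Tor M) (j : Fin (d + 1) → Fin n) (ν : Fin (d + 1)) (a : Fin n) :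
    ‖f (bpt n M y (Function.update j ν a)) - f (bpt n M y j)‖ ≤ ((n : ℝ) - 1) * g := by
  have hn1 : ((n : ℝ) - 1) = ((n - 1 : ℕ) : ℝ) := by
    have : 1 ≤ n := Nat.one_le_iff_ne_zero.mpr (NeZero.ne n)
    push_cast [Nat.cast_sub this]; ring
  rcases le_total (j ν : ℕ) (a : ℕ) with hle | hle
  · -- going up from `j_ν` to `a`
    obtain ⟨m, hm⟩ : ∃ m : ℕ, (a : ℕ) = (j ν : ℕ) + m := ⟨a - j ν, by omega⟩
    have h : (j ν : ℕ) + m < n := by rw [← hm]; exact a.isLt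
    have ha : a = ⟨(j ν : ℕ) + m, h⟩ := Fin.ext hm
    rw [ha]
    refine (norm_sub_le_coord n M f hg hstep y j ν m h).trans (mul_le_mul_of_nonneg_right ?_ hg)
    rw [hn1]; exact_mod_cast (by omega : m ≤ n - 1)
  · -- going up from `a` to `j_ν`, read backwards
    obtain ⟨m, hm⟩ : ∃ m : ℕ, (j ν : ℕ) = (a : ℕ) + m := ⟨j ν - a, by omega⟩
    set j' : Fin (d + 1) → Fin n := Function.update j ν a with hj'
    have hj'ν : (j' ν : ℕ) = a := by rw [hj', Function.update_self]
    have h : (j' ν : ℕ) + m < n := by rw [hj'ν, ← hm]; exact (j ν).isLt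
    have hback : Function.update j' ν ⟨(j' ν : ℕ) + m, h⟩ = j := by
      funext μ
      by_cases hμ : μ = ν
      · rw [hμ, Function.update_self]
        exact Fin.ext (by simp [hj', hm])
      · rw [Function.update_of_ne hμ, hj', Function.update_of_ne hμ]
    have h1 := norm_sub_le_coord n M f hg hstep y j' ν m h
    rw [hback] at h1
    rw [norm_sub_rev]
    refine h1.trans (mul_le_mul_of_nonneg_right ?_ hg)
    rw [hn1]; exact_mod_cast (by omega : m ≤ n - 1)

omit [∀ μ, NeZero (M μ)] in
/-- THE STAIRCASE: any two points of the same block are within `(d+1)(n−1)·g` (change the coordinates below `s` one at a time). [folklore] -/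
theorem norm_sub_le_stair (f : Tor (fine n M) → ℂ) {g : ℝ} (hg : 0 ≤ g)
    (hstep : ∀ (y : Tor M) (j : Fin (d + 1) → Fin n) (ν : Fin (d + 1)) (h : (j ν : ℕ) + 1 < n),
      ‖f (bpt n M y (Function.update j ν ⟨(j ν : ℕ) + 1, h⟩)) - f (bpt n M y j)‖ ≤ g)
    (y : Tor M) (j j' : Fin (d + 1) → Fin n) :
    ∀ s : ℕ, s ≤ d + 1 →
      ‖f (bpt n M y (fun ν => if (ν : ℕ) < s then j' ν else j ν)) - f (bpt n M y j)‖ ≤ (s : ℝ) * (((n : ℝ) - 1) * g)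
  | 0, _ => by simp
  | s + 1, hs => by
      have ih := norm_sub_le_stair f hg hstep y j j' s (by omega)
      set J : Fin (d + 1) → Fin n := fun ν => if (ν : ℕ) < s then j' ν else j ν with hJ
      -- the next staircase point changes only the coordinate `s`
      have hnext : (fun ν : Fin (d + 1) => if (ν : ℕ) < s + 1 then j' ν else j ν) = Function.update J ⟨s, by omega⟩ (j' ⟨s, by omega⟩) := by
        funext ν
        by_cases hν : ν = ⟨s, by omega⟩
        · subst hν; simp
        · have hνs : (ν : ℕ) ≠ s := fun h => hν (Fin.ext h)
          rw [Function.update_of_ne hν, hJ]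
          simp only
          by_cases hlt : (ν : ℕ) < s
          · rw [if_pos (by omega), if_pos hlt]
          · rw [if_neg (by omega), if_neg hlt]
      rw [hnext]
      calc _ ≤ ‖f (bpt n M y (Function.update J ⟨s, by omega⟩ (j' ⟨s, by omega⟩))) - f (bpt n M y J)‖ + ‖f (bpt n M y J) - f (bpt n M y j)‖ := by
            rw [← sub_add_sub_cancel]; exact norm_add_le _ _
        _ ≤ ((n : ℝ) - 1) * g + (s : ℝ) * (((n : ℝ) - 1) * g) := add_le_add (norm_sub_le_coord' n M f hg hstep y J _ _) ih
        _ = ((s + 1 : ℕ) : ℝ) * (((n : ℝ) - 1) * g) := by push_cast; ring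

/-! ## §3 THE LETTER -/

/-- **SUP OF A BLOCK-MEAN-ZERO FUNCTION** (dimension `d + 1`, `n ≥ 1`): if `Q′_kf = 0` and every step inside a block changes `f` by at most `g ≥ 0`, then
`‖f(x)‖ ≤ (d+1)(n−1)·g` for every `x`. [folklore] -/
theorem norm_le_of_blockMean_zero (f : Tor (fine n M) → ℂ) (hQ : QsOp n M *ᵥ f = 0) {g : ℝ} (hg : 0 ≤ g)
    (hstep : ∀ (y : Tor M) (j : Fin (d + 1) → Fin n) (ν : Fin (d + 1)) (h : (j ν : ℕ) + 1 < n),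
      ‖f (bpt n M y (Function.update j ν ⟨(j ν : ℕ) + 1, h⟩)) - f (bpt n M y j)‖ ≤ g)
    (x : Tor (fine n M)) : ‖f x‖ ≤ ((d + 1 : ℕ) : ℝ) * ((n : ℝ) - 1) * g := by
  obtain ⟨j, hx⟩ := exists_eq_bpt_blockOf n M x
  set y := blockOf n M x with hy
  have hnc : (n : ℂ) ≠ 0 := by exact_mod_cast NeZero.ne n
  -- the block mean vanishes: `Σ_{j′} f(ny + j′) = 0`
  have hsum : ∑ j' : Fin (d + 1) → Fin n, f (bpt n M y j') = 0 := by
    have h := congrFun hQ y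
    rw [QsOp_mulVec, Pi.zero_apply, mul_eq_zero] at h
    rcases h with h | h
    · exact absurd h (by simp [hnc])
    · exact h
  -- `f(x)·n^{d+1} = Σ_{j′} (f(x) − f(ny + j′))`
  have hcard : (Fintype.card (Fin (d + 1) → Fin n) : ℂ) = (n : ℂ) ^ (d + 1) := by simp
  have hid : f x = ((n : ℂ) ^ (d + 1))⁻¹ * ∑ j' : Fin (d + 1) → Fin n, (f x - f (bpt n M y j')) := by
    rw [Finset.sum_sub_distrib, hsum, sub_zero, Finset.sum_const, Finset.card_univ, nsmul_eq_mul, hcard, ← mul_assoc,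
      inv_mul_cancel₀ (pow_ne_zero _ hnc), one_mul]
  have hstair : ∀ j' : Fin (d + 1) → Fin n, ‖f x - f (bpt n M y j')‖ ≤ ((d + 1 : ℕ) : ℝ) * ((n : ℝ) - 1) * g := by
    intro j'
    have h := norm_sub_le_stair n M f hg hstep y j' j (d + 1) le_rfl
    have hfun : (fun ν : Fin (d + 1) => if (ν : ℕ) < d + 1 then j ν else j' ν) = j := funext fun ν => if_pos ν.isLt
    rw [hfun, ← hx] at h
    linarith
  rw [hid, norm_mul, norm_inv, norm_pow, Complex.norm_natCast]
  have hn0 : (0 : ℝ) < (n : ℝ) ^ (d + 1) := pow_pos (by exact_mod_cast Nat.pos_of_ne_zero (NeZero.ne n)) _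
  rw [inv_mul_le_iff₀ hn0]
  calc ‖∑ j' : Fin (d + 1) → Fin n, (f x - f (bpt n M y j'))‖ ≤ ∑ j' : Fin (d + 1) → Fin n, ‖f x - f (bpt n M y j')‖ := norm_sum_le _ _
    _ ≤ ∑ _j' : Fin (d + 1) → Fin n, ((d + 1 : ℕ) : ℝ) * ((n : ℝ) - 1) * g := Finset.sum_le_sum fun j' _ => hstair j'
    _ = (n : ℝ) ^ (d + 1) * (((d + 1 : ℕ) : ℝ) * ((n : ℝ) - 1) * g) := by
        rw [Finset.sum_const, Finset.card_univ, nsmul_eq_mul]; simp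

end

end Summit.QuantumFields.BalabanUV.T4Continuum.NE7BlockMeanZeroSup
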